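import Mathlib
import Summits.NavierStokesRegularity.NavierStokesRegularity.Theorems.TypeIIInviscidRelaxationCoreExclusionShadowingViscousWindow
import HarnessLib

/-!
# Cruxes `ColumnarCoreExclusion` (stmt-1966) / `MonopoleCoreExclusion` (stmt-1965): a TYPABLE super-viscous form of
# the shadowing stubs and the kernel glue back to the registered signatures

`--supports stmt-NavierStokesRegularity-1966` (helper file; theorems only, no definitions, no `sorry`).

`CoreExclusionShadowing.columnarShadowing_of_superviscous` / `axisymShadowing_of_superviscous`
(`…CoreExclusionShadowingViscousWindow`, p833576) reduce the registered [XL] stubs `stub_columnarShadowing` (line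
`columnar_comparison_flow`, 1966) and `stub_axisymShadowing` (line `axisymmetric_comparison_flow`, 1965) to their
restrictions to super-viscous horizons `c⋆ν < (T - t)V²`, but with `c⋆` an EXISTENTIAL universal constant (Leray's
doubling constant is not numerically explicit in the tree), which a line-writer cannot type into a registered stub.
This file gives the form that CAN be registered verbatim — the constant is universally quantified together with ITS
DOUBLING PROPERTY as a usable hypothesis:

  `SV := ∀ c > 0, (doubling property of c: speed bound V at t and (T - t)V² ≤ cν ⇒ ‖u‖ ≤ 2V on [t,T) × ℝ³) →
        (the registered stub with the extra hypothesis cν < (T - t)V²)`,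

and proves the glue `SV → registered stub` for both classes (`columnarShadowing_of_superviscousForm`,
`axisymShadowing_of_superviscousForm`): instantiate `c` at the constant of
`CoreExclusionShadowing.exists_viscousWindow_const`, whose first conjunct IS the doubling property, and split cases on
the window.  `SV` is implied by the registered stub (drop two hypotheses), so the two forms are equivalent; the
super-viscous form hands a prover Leray's doubling at the threshold constant for free and removes the viscous window
from the statement.  Honest framing: bookkeeping for a planner re-line (census R3 of hands 6-g2/6-g3); the [XL]
content is untouched; nothing about Navier–Stokes regularity is claimed; no stub is closed by name.
-/

noncomputable section

open Set Metric MeasureTheory Function Filter Topology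
open Literature.Analysis Literature.Analysis.FluidPDE
open scoped ENNReal

namespace Summit.NavierStokesRegularity.NavierStokesRegularity.Theorems

-- the problem directory repeats the summit name (`NavierStokesRegularity/NavierStokesRegularity`)
set_option linter.dupNamespace false

namespace CoreExclusionShadowing

/-- **Glue, columnar class.**  The TYPABLE super-viscous form of `stub_columnarShadowing` — for every `c > 0`
carrying the doubling property «`‖u(t,·)‖ ≤ V`, `(T - t)V² ≤ cν` ⇒ `‖u‖ ≤ 2V` on `[t,T) × ℝ³`» (for classical
solutions on `[0,T)`, Leray–Hopf from `u(0)`), the registered statement restricted to `cν < (T - t)V²` — implies the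
registered stub verbatim (conclusion).  Proof: take `c = c⋆` from `exists_viscousWindow_const` (its first conjunct is
the doubling property) and split on the window. [cite: Leray1934, §21 (3.15) p. 226] -/
theorem columnarShadowing_of_superviscousForm
    (hSV : ∀ c : ℝ, 0 < c →
      (∀ (ν T t V : ℝ) (u : ℝ → EuclideanSpace ℝ (Fin 3) → EuclideanSpace ℝ (Fin 3))
        (p : ℝ → EuclideanSpace ℝ (Fin 3) → ℝ),
        0 < ν → 0 < T → IsClassicalNSSolutionOn (Ico 0 T) ν 0 u p → IsLerayHopfOn T ν 0 (u 0) u →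
        0 ≤ t → t < T → 0 < V → (∀ x, ‖u t x‖ ≤ V) → (T - t) * V ^ 2 ≤ c * ν →
        ∀ s ∈ Ico t T, ∀ x, ‖u s x‖ ≤ 2 * V) →
      ∀ A : ℝ, 0 < A → ∃ K₀ : ℝ, 1 ≤ K₀ ∧ ∀ K : ℝ, K₀ ≤ K →
      ∀ (ν T t : ℝ) (u : ℝ → EuclideanSpace ℝ (Fin 3) → EuclideanSpace ℝ (Fin 3))
        (p : ℝ → EuclideanSpace ℝ (Fin 3) → ℝ),
        0 < ν → 0 < T → IsClassicalNSSolutionOn (Ico 0 T) ν 0 u p → IsLerayHopfOn T ν 0 (u 0) u →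
        HasRapidSpatialDecay (u 0) → 0 < t → t < T →
        ∀ (x₀ : EuclideanSpace ℝ (Fin 3)) (L V : ℝ)
          (Q : EuclideanSpace ℝ (Fin 3) ≃ₗᵢ[ℝ] EuclideanSpace ℝ (Fin 3)),
          0 < L → 0 < V → (∀ x, ‖u t x‖ ≤ V) →
          (∃ x₁, dist x₁ x₀ ≤ L ∧ V ≤ 2 * ‖u t x₁‖) → K * ν ≤ L * V → (T - t) * V ≤ K * L →
          c * ν < (T - t) * V ^ 2 →
          ∀ (v : ℝ → EuclideanSpace ℝ (Fin 3) → EuclideanSpace ℝ (Fin 3))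
            (q : ℝ → EuclideanSpace ℝ (Fin 3) → ℝ) (Mv : ℝ),
            IsClassicalNSSolutionOn (Icc t T) ν 0 v q →
            (∀ s ∈ Icc t T, ∀ (x : EuclideanSpace ℝ (Fin 3)) (τ : ℝ), v s (x + τ • Q eZ) = v s x) →
            (∀ s ∈ Icc t T, ∀ x, ‖v s x‖ ≤ Mv) →
            (∀ x ∈ ball x₀ (K * L / 2), ‖u t x - v t x‖ ≤ A * V / K) →
            ∃ M : ℝ, ∀ s ∈ Ico t T, ∀ x ∈ ball x₀ (3 * K * L / 8), ‖u s x‖ ≤ M) :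
    ∀ A : ℝ, 0 < A → ∃ K₀ : ℝ, 1 ≤ K₀ ∧ ∀ K : ℝ, K₀ ≤ K →
      ∀ (ν T t : ℝ) (u : ℝ → EuclideanSpace ℝ (Fin 3) → EuclideanSpace ℝ (Fin 3))
        (p : ℝ → EuclideanSpace ℝ (Fin 3) → ℝ),
        0 < ν → 0 < T → IsClassicalNSSolutionOn (Ico 0 T) ν 0 u p → IsLerayHopfOn T ν 0 (u 0) u →
        HasRapidSpatialDecay (u 0) → 0 < t → t < T →
        ∀ (x₀ : EuclideanSpace ℝ (Fin 3)) (L V : ℝ)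
          (Q : EuclideanSpace ℝ (Fin 3) ≃ₗᵢ[ℝ] EuclideanSpace ℝ (Fin 3)),
          0 < L → 0 < V → (∀ x, ‖u t x‖ ≤ V) →
          (∃ x₁, dist x₁ x₀ ≤ L ∧ V ≤ 2 * ‖u t x₁‖) → K * ν ≤ L * V → (T - t) * V ≤ K * L →
          ∀ (v : ℝ → EuclideanSpace ℝ (Fin 3) → EuclideanSpace ℝ (Fin 3))
            (q : ℝ → EuclideanSpace ℝ (Fin 3) → ℝ) (Mv : ℝ),
            IsClassicalNSSolutionOn (Icc t T) ν 0 v q →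
            (∀ s ∈ Icc t T, ∀ (x : EuclideanSpace ℝ (Fin 3)) (τ : ℝ), v s (x + τ • Q eZ) = v s x) →
            (∀ s ∈ Icc t T, ∀ x, ‖v s x‖ ≤ Mv) →
            (∀ x ∈ ball x₀ (K * L / 2), ‖u t x - v t x‖ ≤ A * V / K) →
            ∃ M : ℝ, ∀ s ∈ Ico t T, ∀ x ∈ ball x₀ (3 * K * L / 8), ‖u s x‖ ≤ M := by
  obtain ⟨c, hc, hdbl, -⟩ := exists_viscousWindow_const
  have hS := hSV c hc (fun ν T t V u p hν hT hcl hLH ht htT hV hbd hwin s hs x =>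
    hdbl hν hT hcl hLH ht htT hV hbd hwin s hs x)
  intro A hA
  obtain ⟨K₀, hK₀, hK⟩ := hS A hA
  refine ⟨K₀, hK₀, ?_⟩
  intro K hKK ν T t u p hν hT hcl hLH hdec ht htT x₀ L V Q hL hV hbd hnear hRe hlate v q Mv hv hvcol hvbd
    hclose
  by_cases hwin : (T - t) * V ^ 2 ≤ c * ν
  · exact ⟨2 * V, fun s hs x _ => hdbl hν hT hcl hLH ht.le htT hV hbd hwin s hs x⟩
  · exact hK K hKK ν T t u p hν hT hcl hLH hdec ht htT x₀ L V Q hL hV hbd hnear hRe hlate (lt_of_not_ge hwin)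
      v q Mv hv hvcol hvbd hclose

/-- **Glue, axisymmetric class.**  The TYPABLE super-viscous form of `stub_axisymShadowing` (same shape: `∀ c > 0`,
doubling property of `c`, registered statement restricted to `cν < (T - t)V²`) implies the registered stub verbatim.
[cite: Leray1934, §21 (3.15) p. 226] -/
theorem axisymShadowing_of_superviscousForm
    (hSV : ∀ c : ℝ, 0 < c →
      (∀ (ν T t V : ℝ) (u : ℝ → EuclideanSpace ℝ (Fin 3) → EuclideanSpace ℝ (Fin 3))
        (p : ℝ → EuclideanSpace ℝ (Fin 3) → ℝ),
        0 < ν → 0 < T → IsClassicalNSSolutionOn (Ico 0 T) ν 0 u p → IsLerayHopfOn T ν 0 (u 0) u →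
        0 ≤ t → t < T → 0 < V → (∀ x, ‖u t x‖ ≤ V) → (T - t) * V ^ 2 ≤ c * ν →
        ∀ s ∈ Ico t T, ∀ x, ‖u s x‖ ≤ 2 * V) →
      ∀ A : ℝ, 0 < A → ∃ K₀ : ℝ, 1 ≤ K₀ ∧ ∀ K : ℝ, K₀ ≤ K →
      ∀ (ν T t : ℝ) (u : ℝ → EuclideanSpace ℝ (Fin 3) → EuclideanSpace ℝ (Fin 3))
        (p : ℝ → EuclideanSpace ℝ (Fin 3) → ℝ),
        0 < ν → 0 < T → IsClassicalNSSolutionOn (Ico 0 T) ν 0 u p → IsLerayHopfOn T ν 0 (u 0) u →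
        HasRapidSpatialDecay (u 0) → 0 < t → t < T →
        ∀ (x₀ : EuclideanSpace ℝ (Fin 3)) (L V : ℝ)
          (Q : EuclideanSpace ℝ (Fin 3) ≃ₗᵢ[ℝ] EuclideanSpace ℝ (Fin 3)),
          0 < L → 0 < V → (∀ x, ‖u t x‖ ≤ V) →
          (∃ x₁, dist x₁ x₀ ≤ L ∧ V ≤ 2 * ‖u t x₁‖) → K * ν ≤ L * V → (T - t) * V ≤ K * L →
          c * ν < (T - t) * V ^ 2 →
          ∀ (v : ℝ → EuclideanSpace ℝ (Fin 3) → EuclideanSpace ℝ (Fin 3))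
            (q : ℝ → EuclideanSpace ℝ (Fin 3) → ℝ) (Mv : ℝ),
            IsClassicalNSSolutionOn (Icc t T) ν 0 v q →
            (∀ s ∈ Icc t T, IsAxisymmetric (fun y : EuclideanSpace ℝ (Fin 3) => Q.symm (v s (x₀ + Q y)))) →
            (∀ s ∈ Icc t T, ∀ x, ‖v s x‖ ≤ Mv) →
            (∀ x ∈ ball x₀ (K * L), ‖u t x - v t x‖ ≤ A * V / K) →
            ∃ M : ℝ, ∀ s ∈ Ico t T, ∀ x ∈ ball x₀ (K * L / 2), ‖u s x‖ ≤ M) :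
    ∀ A : ℝ, 0 < A → ∃ K₀ : ℝ, 1 ≤ K₀ ∧ ∀ K : ℝ, K₀ ≤ K →
      ∀ (ν T t : ℝ) (u : ℝ → EuclideanSpace ℝ (Fin 3) → EuclideanSpace ℝ (Fin 3))
        (p : ℝ → EuclideanSpace ℝ (Fin 3) → ℝ),
        0 < ν → 0 < T → IsClassicalNSSolutionOn (Ico 0 T) ν 0 u p → IsLerayHopfOn T ν 0 (u 0) u →
        HasRapidSpatialDecay (u 0) → 0 < t → t < T →
        ∀ (x₀ : EuclideanSpace ℝ (Fin 3)) (L V : ℝ)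
          (Q : EuclideanSpace ℝ (Fin 3) ≃ₗᵢ[ℝ] EuclideanSpace ℝ (Fin 3)),
          0 < L → 0 < V → (∀ x, ‖u t x‖ ≤ V) →
          (∃ x₁, dist x₁ x₀ ≤ L ∧ V ≤ 2 * ‖u t x₁‖) → K * ν ≤ L * V → (T - t) * V ≤ K * L →
          ∀ (v : ℝ → EuclideanSpace ℝ (Fin 3) → EuclideanSpace ℝ (Fin 3))
            (q : ℝ → EuclideanSpace ℝ (Fin 3) → ℝ) (Mv : ℝ),
            IsClassicalNSSolutionOn (Icc t T) ν 0 v q →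
            (∀ s ∈ Icc t T, IsAxisymmetric (fun y : EuclideanSpace ℝ (Fin 3) => Q.symm (v s (x₀ + Q y)))) →
            (∀ s ∈ Icc t T, ∀ x, ‖v s x‖ ≤ Mv) →
            (∀ x ∈ ball x₀ (K * L), ‖u t x - v t x‖ ≤ A * V / K) →
            ∃ M : ℝ, ∀ s ∈ Ico t T, ∀ x ∈ ball x₀ (K * L / 2), ‖u s x‖ ≤ M := by
  obtain ⟨c, hc, hdbl, -⟩ := exists_viscousWindow_const
  have hS := hSV c hc (fun ν T t V u p hν hT hcl hLH ht htT hV hbd hwin s hs x =>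
    hdbl hν hT hcl hLH ht htT hV hbd hwin s hs x)
  intro A hA
  obtain ⟨K₀, hK₀, hK⟩ := hS A hA
  refine ⟨K₀, hK₀, ?_⟩
  intro K hKK ν T t u p hν hT hcl hLH hdec ht htT x₀ L V Q hL hV hbd hnear hRe hlate v q Mv hv hvax hvbd
    hclose
  by_cases hwin : (T - t) * V ^ 2 ≤ c * ν
  · exact ⟨2 * V, fun s hs x _ => hdbl hν hT hcl hLH ht.le htT hV hbd hwin s hs x⟩
  · exact hK K hKK ν T t u p hν hT hcl hLH hdec ht htT x₀ L V Q hL hV hbd hnear hRe hlate (lt_of_not_ge hwin)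
      v q Mv hv hvax hvbd hclose

end CoreExclusionShadowing

end Summit.NavierStokesRegularity.NavierStokesRegularity.Theorems

end
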